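import Literature.NumberTheory.QuadraticFields.InfrastructureGiantStep
import Literature.NumberTheory.QuadraticFields.RealQuadraticInfrastructureDistance
import Literature.Computability.Cryptography.HallgrenComposition
import Literature.Computability.Cryptography.InfrastructurePrimitives
import HarnessLib

/-!
# Hallgren's giant step on the principal cycle: `x_i * x_j = reduce (comp x_i x_j)` lands on the cycle

Topic `Computability/Cryptography`; joins `HallgrenComposition.lean` (Gauss composition `comp` of two
ideal-shaped quotients, `L(x)·L(y) = 2d · L(comp x y)`), the reduction `QuadIrr.reduce`
(`J(reduce x) = reduceMult x · J(x)`) and the identification theorem of the principal cycle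
(`QuadIrr.exists_iterate_eq_of_jmod_eq_smul`: a reduced quotient with module `κ·O` is a cycle
element `x_n` with `κ = Π_n εʲ`). Result (Jozsa 2003, §7.1–7.2, §8: the product of two principal
reduced ideals at distances `δ_i`, `δ_j` is, after reduction, a principal reduced ideal at distance
`δ_i + δ_j + κ (mod R)` with a small correction `κ`). Theorem-and-definition file, no named facts:

* `isIdealShaped_cycle` (cycle elements are ideal-shaped; the ring property of `O = J(δ)` and the
  `ℚ(√D)`-membership of `reduceMult` are `QuadIrr.mul_mem_jmod_principalStart`, `QuadIrr.isQD_gaussMult`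
  of `InfrastructureGiantStep.lean`, which treats the squaring case of the giant step);
* **`mem_jmod_comp_iff`** — `J(comp a b) = (Q_a Q_b π_a π_b / 2dQ_c) · O` when `J(a) = π_a O`,
  `J(b) = π_b O`;
* `starQ a b = reduce (comp a b)`; **`exists_starQ_eq`** — for cycle elements `a = x_{i+1}`,
  `b = x_{j+1}`: `starQ a b = x_n`, `1 ≤ n ≤ p`, with
  `|reduceMult| · Q_aQ_bΠ_{i+1}Π_{j+1}/(2dQ_c) = Π_n εʲ'`;
* `pos_eq_log_valProd`, `kappaQ`, and the distance form **`exists_pos_starQ`**: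
  `ρᵏ x₁ = starQ a b` with `pos k = pos i + pos j + kappaQ a b + l·R`.

## References

* R. Jozsa, arXiv:quant-ph/0302134 (2003), §6.2 Prop. 21, §6.3 Thm. 4(c), §7.1 Props. 34–35, §8. [Jozsa2003]
* M. J. Jacobson, Jr., H. C. Williams, *Solving the Pell Equation*, Springer (2009), §5.3 Thm. 5.18,
  §5.4. [JacobsonWilliams2008]
-/

noncomputable section

open scoped Classical

namespace Literature.Computability.Cryptography

namespace HallgrenGiantStep

open Literature.NumberTheory.QuadraticFields Literature.NumberTheory.QuadraticFields.QuadIrr HallgrenComposition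

variable {D : ℕ}

/-! ### The order `O = J(δ)` -/

/-- Rational numbers are in `ℚ(√D)`. [folklore] -/
theorem isQD_ratCast (r : ℚ) : IsQD D (r : ℝ) := ⟨r, 0, by simp [qd]⟩

/-- `−t ∈ O ↔ t ∈ O`; used to absorb signs into `O`. [folklore] -/
theorem exists_mul_iff_abs {x : QuadIrr D} {r : ℝ} (t : ℝ) :
    (∃ s ∈ jmod x, t = r * s) ↔ ∃ s ∈ jmod x, t = |r| * s := by
  rcases le_total 0 r with hr | hr
  · rw [abs_of_nonneg hr]
  · rw [abs_of_nonpos hr]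
    constructor
    · rintro ⟨s, hs, rfl⟩; exact ⟨-s, neg_mem hs, by ring⟩
    · rintro ⟨s, hs, rfl⟩; exact ⟨-s, neg_mem hs, by ring⟩

/-! ### Cycle elements are ideal-shaped -/

/-- **Every element of the principal cycle is ideal-shaped** (`ρⁱ x₁ = ρ^{i+1} δ`; wrapper of
`QuadIrr.isIdealShaped_iterate`). [cite: Jozsa2003, §6.2 Prop. 19] -/
theorem isIdealShaped_cycle (hD : ¬ IsSquare D) (hD4 : D % 4 = 0 ∨ D % 4 = 1) (i : ℕ) :
    (step^[i] (principalFirst D)).IsIdealShaped := by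
  rw [← iterate_succ_principalStart]; exact isIdealShaped_iterate hD hD4 (i + 1)

/-! ### The module of the composition -/

/-- `2dQ_c ≠ 0` bookkeeping: membership in `L(c)` through `2d · L(c) = L(a)L(b)`. [folklore] -/
theorem mem_latZ_comp_iff (hD4 : D % 4 = 0 ∨ D % 4 = 1) {a b : QuadIrr D} (ha : a.IsIdealShaped) (hb : b.IsIdealShaped)
    (t : ℝ) : t ∈ latZ (comp a b) ↔ (2 * compScalar a b : ℝ) * t ∈ latZ a * latZ b := by
  rw [latZ_mul_latZ_comp hD4 ha hb]
  have hd : (2 * compScalar a b : ℝ) ≠ 0 := by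
    have := compScalar_pos (y := b) ha; positivity
  constructor
  · intro h
    rw [mem_latZ_iff] at h
    obtain ⟨m, n, rfl⟩ := h
    rw [Submodule.mem_span_pair]
    exact ⟨m, n, by simp only [zsmul_eq_mul]; ring⟩
  · intro h
    rw [Submodule.mem_span_pair] at h
    obtain ⟨m, n, h⟩ := h
    simp only [zsmul_eq_mul] at h
    rw [mem_latZ_iff]
    refine ⟨m, n, ?_⟩
    apply mul_left_cancel₀ hd
    rw [← h]; ring

/-- **The module of the composition**: if `J(a) = π_a O` and `J(b) = π_b O` (`π_a, π_b > 0`) then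
`J(comp a b) = (Q_a Q_b π_a π_b / (2 d Q_c)) · O`. [cite: Jozsa2003, §7.1 Prop. 34 (I₁I₂ = (d) I₃)] -/
theorem mem_jmod_comp_iff (hD4 : D % 4 = 0 ∨ D % 4 = 1) {a b : QuadIrr D} (ha : a.IsIdealShaped)
    (hb : b.IsIdealShaped) {πa πb : ℝ}
    (hJa : ∀ t, t ∈ jmod a ↔ ∃ s ∈ jmod (principalStart D), t = πa * s)
    (hJb : ∀ t, t ∈ jmod b ↔ ∃ s ∈ jmod (principalStart D), t = πb * s) (t : ℝ) :
    t ∈ jmod (comp a b) ↔ ∃ s ∈ jmod (principalStart D),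
      t = ((a.Q : ℝ) * b.Q * πa * πb / (2 * compScalar a b * (comp a b).Q)) * s := by
  have hQa : a.Q ≠ 0 := ha.1.ne'
  have hQb : b.Q ≠ 0 := hb.1.ne'
  have hQc : (comp a b).Q ≠ 0 := (comp_Q_pos hD4 ha hb).ne'
  have hQcR : ((comp a b).Q : ℝ) ≠ 0 := by exact_mod_cast hQc
  have hQaR : (a.Q : ℝ) ≠ 0 := by exact_mod_cast hQa
  have hQbR : (b.Q : ℝ) ≠ 0 := by exact_mod_cast hQb
  have hd : (2 * compScalar a b : ℝ) ≠ 0 := by have := compScalar_pos (y := b) ha; positivity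
  set κ' : ℝ := (a.Q : ℝ) * b.Q * πa * πb with hκ'
  -- every element of `L(a)L(b)` is `κ' s`, `s ∈ O`
  have hprod : ∀ u ∈ latZ a * latZ b, ∃ s ∈ jmod (principalStart D), u = κ' * s := by
    intro u hu
    refine Submodule.mul_induction_on hu ?_ ?_
    · intro m hm n hn
      rw [mem_latZ_iff_mem_jmod hQa, hJa] at hm
      rw [mem_latZ_iff_mem_jmod hQb, hJb] at hn
      obtain ⟨s₁, hs₁, h₁⟩ := hm
      obtain ⟨s₂, hs₂, h₂⟩ := hn
      refine ⟨s₁ * s₂, mul_mem_jmod_principalStart hD4 hs₁ hs₂, ?_⟩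
      have hm' : m = a.Q * (πa * s₁) := by field_simp at h₁; linarith
      have hn' : n = b.Q * (πb * s₂) := by field_simp at h₂; linarith
      rw [hm', hn', hκ']; ring
    · rintro u v ⟨s, hs, rfl⟩ ⟨s', hs', rfl⟩
      exact ⟨s + s', add_mem hs hs', by ring⟩
  constructor
  · intro ht
    have h1 : ((comp a b).Q : ℝ) * t ∈ latZ (comp a b) := by
      rw [mem_latZ_iff_mem_jmod hQc]; simpa [mul_div_cancel_left₀ _ hQcR] using ht
    rw [mem_latZ_comp_iff hD4 ha hb] at h1
    obtain ⟨s, hs, hs'⟩ := hprod _ h1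
    refine ⟨s, hs, ?_⟩
    rw [hκ'] at hs'
    have hne : (2 * compScalar a b * (comp a b).Q : ℝ) ≠ 0 := mul_ne_zero hd hQcR
    have h2 : (2 * compScalar a b * (comp a b).Q : ℝ) * t = (a.Q : ℝ) * b.Q * πa * πb * s := by
      rw [← hs']; ring
    calc t = (2 * compScalar a b * (comp a b).Q : ℝ) * t / (2 * compScalar a b * (comp a b).Q) :=
            (mul_div_cancel_left₀ t hne).symm
      _ = (a.Q : ℝ) * b.Q * πa * πb * s / (2 * compScalar a b * (comp a b).Q) := by rw [h2]
      _ = _ := by ring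
  · rintro ⟨s, hs, rfl⟩
    -- `2dQ_c t = κ' s = (Q_a πa s)(Q_b πb) ∈ L(a)L(b)`
    have hm : (a.Q : ℝ) * (πa * s) ∈ latZ a := by
      rw [mem_latZ_iff_mem_jmod hQa, hJa]
      exact ⟨s, hs, by field_simp⟩
    have hn : (b.Q : ℝ) * πb ∈ latZ b := by
      rw [mem_latZ_iff_mem_jmod hQb, hJb]
      refine ⟨1, ?_, by field_simp⟩
      rw [mem_jmod_iff]; exact ⟨1, 0, by simp⟩
    have hmn := Submodule.mul_mem_mul hm hn
    have hd' : (compScalar a b : ℝ) ≠ 0 := by have := compScalar_pos (y := b) ha; positivity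
    have hval : (a.Q : ℝ) * (πa * s) * ((b.Q : ℝ) * πb) =
        (2 * compScalar a b : ℝ) * (((comp a b).Q : ℝ) * (((a.Q : ℝ) * b.Q * πa * πb / (2 * compScalar a b * (comp a b).Q)) * s)) := by
      field_simp
    rw [hval, ← mem_latZ_comp_iff hD4 ha hb, mem_latZ_iff_mem_jmod hQc] at hmn
    simpa [mul_div_cancel_left₀ _ hQcR] using hmn

/-! ### The giant step and its landing -/

/-- **Hallgren's giant step**: compose, then reduce. [cite: Jozsa2003, §7.2 (I * J = reduction of IJ)] -/
def starQ (a b : QuadIrr D) : QuadIrr D := reduce (comp a b)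

/-- The module of a cycle element: `J(x_{i+1}) = Π_{i+1} O`. [cite: Jozsa2003, §6.3 Prop. 25] -/
theorem mem_jmod_cycle_iff (hD : ¬ IsSquare D) (hD4 : D % 4 = 0 ∨ D % 4 = 1) (i : ℕ) (t : ℝ) :
    t ∈ jmod (step^[i] (principalFirst D)) ↔
      ∃ s ∈ jmod (principalStart D), t = valProd (principalStart D) (i + 1) * s := by
  rw [← iterate_succ_principalStart]
  exact mem_jmod_iterate_iff hD (isPreReduced_principalStart hD hD4) (i + 1) t

/-- **The giant step lands on the principal cycle**: for `a = x_{i+1}`, `b = x_{j+1}`,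
`starQ a b = x_n` with `1 ≤ n ≤ p` and `|reduceMult| · Q_aQ_bΠ_{i+1}Π_{j+1}/(2dQ_c) = Π_n εʲ'`.
[cite: Jozsa2003, §6.3 Thm. 4(c), §7.2] [cite: JacobsonWilliams2008, Thm. 5.18] -/
theorem exists_starQ_eq (hD : ¬ IsSquare D) (hD4 : D % 4 = 0 ∨ D % 4 = 1) (i j : ℕ) :
    ∃ n : ℕ, 1 ≤ n ∧ n ≤ periodLength D ∧
      starQ (step^[i] (principalFirst D)) (step^[j] (principalFirst D)) = step^[n] (principalStart D) ∧
      ∃ j' : ℤ, |reduceMult (comp (step^[i] (principalFirst D)) (step^[j] (principalFirst D)))| *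
          (((step^[i] (principalFirst D)).Q : ℝ) * (step^[j] (principalFirst D)).Q *
            valProd (principalStart D) (i + 1) * valProd (principalStart D) (j + 1) /
            (2 * compScalar (step^[i] (principalFirst D)) (step^[j] (principalFirst D)) *
              (comp (step^[i] (principalFirst D)) (step^[j] (principalFirst D))).Q)) =
        valProd (principalStart D) n * fundUnit D ^ j' := by
  set a := step^[i] (principalFirst D) with ha'
  set b := step^[j] (principalFirst D) with hb'
  have ha : a.IsIdealShaped := isIdealShaped_cycle hD hD4 i
  have hb : b.IsIdealShaped := isIdealShaped_cycle hD hD4 j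
  set c := comp a b with hc
  have hcsh : c.IsIdealShaped := isIdealShaped_comp hD4 ha hb
  have hcadm : c.IsAdmissible := hcsh.isAdmissible
  have hcQ : 0 < c.Q := comp_Q_pos hD4 ha hb
  have h0 := isPreReduced_principalStart hD hD4
  set πa := valProd (principalStart D) (i + 1)
  set πb := valProd (principalStart D) (j + 1)
  have hπa : 0 < πa := valProd_pos hD h0 _
  have hπb : 0 < πb := valProd_pos hD h0 _
  set μ : ℝ := (a.Q : ℝ) * b.Q * πa * πb / (2 * compScalar a b * c.Q) with hμ
  have hd : 0 < compScalar a b := compScalar_pos (y := b) ha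
  have hμpos : 0 < μ := by
    rw [hμ]
    have : (0 : ℝ) < a.Q := by exact_mod_cast ha.1
    have : (0 : ℝ) < b.Q := by exact_mod_cast hb.1
    have : (0 : ℝ) < c.Q := by exact_mod_cast hcQ
    have : (0 : ℝ) < compScalar a b := by exact_mod_cast hd
    positivity
  have hr0 : reduceMult c ≠ 0 := reduceMult_ne_zero hD hcadm hcQ
  set κ : ℝ := |reduceMult c| * μ with hκ
  have hκpos : 0 < κ := mul_pos (abs_pos.mpr hr0) hμpos
  -- `κ ∈ ℚ(√D)`
  have hκQ : IsQD D κ := by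
    have hr : IsQD D (reduceMult c) := isQD_gaussMult _ _
    have habs : IsQD D |reduceMult c| := by
      rcases le_total 0 (reduceMult c) with h | h
      · rw [abs_of_nonneg h]; exact hr
      · rw [abs_of_nonpos h]; exact hr.neg
    have hμQ : IsQD D μ := by
      rw [hμ, div_eq_mul_inv]
      refine IsQD.mul (IsQD.mul (IsQD.mul (IsQD.mul ?_ ?_) (isQD_valProd _ _)) (isQD_valProd _ _)) ?_
      · simpa using isQD_ratCast (D := D) a.Q
      · simpa using isQD_ratCast (D := D) b.Q
      · have : ((2 * compScalar a b * c.Q : ℝ))⁻¹ = (((2 * compScalar a b * c.Q : ℚ))⁻¹ : ℚ) := by push_cast; rfl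
        rw [this]; exact isQD_ratCast _
    exact habs.mul hμQ
  -- the module of `reduce c`
  have hJ : ∀ t, t ∈ jmod (reduce c) ↔ ∃ s ∈ jmod (principalStart D), t = κ * s := by
    intro t
    rw [mem_jmod_reduce_iff hD hcadm hcQ]
    have hcomp := mem_jmod_comp_iff hD4 ha hb (mem_jmod_cycle_iff hD hD4 i) (mem_jmod_cycle_iff hD hD4 j)
    constructor
    · rintro ⟨s, hs, rfl⟩
      rw [hcomp] at hs
      obtain ⟨o, ho, rfl⟩ := hs
      have : ∃ o' ∈ jmod (principalStart D), reduceMult c * (μ * o) = reduceMult c * o' * μ :=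
        ⟨o, ho, by ring⟩
      obtain ⟨o', ho', h'⟩ := (exists_mul_iff_abs (x := principalStart D) (r := reduceMult c) (reduceMult c * o)).mp ⟨o, ho, rfl⟩
      refine ⟨o', ho', ?_⟩
      rw [hκ]
      calc reduceMult c * (μ * o) = (reduceMult c * o) * μ := by ring
        _ = |reduceMult c| * o' * μ := by rw [h']
        _ = |reduceMult c| * μ * o' := by ring
    · rintro ⟨o, ho, rfl⟩
      obtain ⟨o', ho', h'⟩ := (exists_mul_iff_abs (x := principalStart D) (r := reduceMult c) (|reduceMult c| * o)).mpr ⟨o, ho, rfl⟩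
      refine ⟨μ * o', (hcomp _).mpr ⟨o', ho', rfl⟩, ?_⟩
      rw [hκ]
      calc |reduceMult c| * μ * o = (|reduceMult c| * o) * μ := by ring
        _ = reduceMult c * o' * μ := by rw [h']
        _ = reduceMult c * (μ * o') := by ring
  obtain ⟨n, hn1, hnp, hw, j', hj'⟩ :=
    exists_iterate_eq_of_jmod_eq_smul hD hD4 (isReduced_reduce hD hcadm hcQ) hκpos hκQ hJ
  exact ⟨n, hn1, hnp, hw, j', by rw [← hj']⟩

/-! ### Distances -/

/-- `pos m = log Π_m`. [cite: Jozsa2003, §6.3 (δ(x_m) = Σ log φ_k)] -/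
theorem pos_eq_log_valProd (hD : ¬ IsSquare D) (hD4 : D % 4 = 0 ∨ D % 4 = 1) (m : ℕ) :
    pos D m = Real.log (valProd (principalStart D) m) := by
  unfold pos gap valProd
  rw [Real.log_prod]
  · simp only [iterate_succ_principalStart]
  · intro k _
    rw [iterate_succ_principalStart]
    have := (isReduced_iterate hD (isReduced_principalFirst hD hD4) k).2.2.1
    positivity

/-- **The distance correction of the giant step** (a function of the two cycle elements only):
`κ(a, b) = log|reduceMult c| + log(Q_aQ_b/(2dQ_c)) + log φ_a + log φ_b − log φ_{a*b}`.
[cite: Jozsa2003, §7.2 (δ(I*J) = δ(I) + δ(J) + correction)] -/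
def kappaQ (a b : QuadIrr D) : ℝ :=
  Real.log |reduceMult (comp a b)| + Real.log ((a.Q : ℝ) * b.Q / (2 * compScalar a b * (comp a b).Q)) +
    Real.log a.val + Real.log b.val - Real.log (starQ a b).val

/-- **The giant step in distances**: `ρᵏ x₁ = starQ x_{i+1} x_{j+1}` for some `k < p` with
`pos k = pos i + pos j + κ(a, b) + l·R`, `l ∈ ℤ`. [cite: Jozsa2003, §7.2, §8] -/
theorem exists_pos_starQ (hD : ¬ IsSquare D) (hD4 : D % 4 = 0 ∨ D % 4 = 1) (i j : ℕ) :
    ∃ (k : ℕ) (l : ℤ), k < periodLength D ∧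
      step^[k] (principalFirst D) = starQ (step^[i] (principalFirst D)) (step^[j] (principalFirst D)) ∧
      pos D k = pos D i + pos D j + kappaQ (step^[i] (principalFirst D)) (step^[j] (principalFirst D)) +
        l * Real.log (fundUnit D) := by
  obtain ⟨n, hn1, hnp, hw, j', hj'⟩ := exists_starQ_eq hD hD4 i j
  set a := step^[i] (principalFirst D) with ha'
  set b := step^[j] (principalFirst D) with hb'
  have ha : a.IsIdealShaped := isIdealShaped_cycle hD hD4 i
  have hb : b.IsIdealShaped := isIdealShaped_cycle hD hD4 j
  have hcQ : 0 < (comp a b).Q := comp_Q_pos hD4 ha hb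
  have hcadm : (comp a b).IsAdmissible := (isIdealShaped_comp hD4 ha hb).isAdmissible
  have h0 := isPreReduced_principalStart hD hD4
  obtain ⟨k, rfl⟩ : ∃ k, n = k + 1 := ⟨n - 1, by omega⟩
  refine ⟨k, -j', by omega, ?_, ?_⟩
  · rw [← iterate_succ_principalStart, ← hw]
  · -- take logarithms in `hj'`
    have hε : 0 < fundUnit D := by linarith [one_lt_fundUnit hD hD4]
    have hπ : ∀ m, 0 < valProd (principalStart D) m := valProd_pos hD h0
    have hQa : (0 : ℝ) < a.Q := by exact_mod_cast ha.1
    have hQb : (0 : ℝ) < b.Q := by exact_mod_cast hb.1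
    have hQc : (0 : ℝ) < (comp a b).Q := by exact_mod_cast hcQ
    have hd : (0 : ℝ) < compScalar a b := by exact_mod_cast compScalar_pos (y := b) ha
    have hr : 0 < |reduceMult (comp a b)| := abs_pos.mpr (reduceMult_ne_zero hD hcadm hcQ)
    have hval : ∀ m, 0 < (step^[m] (principalFirst D)).val := fun m => by
      have := (isReduced_iterate hD (isReduced_principalFirst hD hD4) m).2.2.1; linarith
    have hw' : step^[k] (principalFirst D) = starQ a b := by rw [← iterate_succ_principalStart, ← hw]
    -- `log Π_{m+1} = pos m + log φ(x_{m+1})`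
    have e3 : ∀ m, Real.log (valProd (principalStart D) (m + 1)) = pos D m + Real.log (step^[m] (principalFirst D)).val := by
      intro m
      rw [valProd_succ, iterate_succ_principalStart, Real.log_mul (hπ m).ne' (hval m).ne', pos_eq_log_valProd hD hD4]
    have e1 : Real.log (|reduceMult (comp a b)| * (((a.Q : ℝ) * b.Q * valProd (principalStart D) (i + 1) *
        valProd (principalStart D) (j + 1)) / (2 * compScalar a b * (comp a b).Q))) =
        Real.log |reduceMult (comp a b)| + Real.log ((a.Q : ℝ) * b.Q / (2 * compScalar a b * (comp a b).Q)) +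
          Real.log (valProd (principalStart D) (i + 1)) + Real.log (valProd (principalStart D) (j + 1)) := by
      rw [show ((a.Q : ℝ) * b.Q * valProd (principalStart D) (i + 1) * valProd (principalStart D) (j + 1)) /
          (2 * compScalar a b * (comp a b).Q) = ((a.Q : ℝ) * b.Q / (2 * compScalar a b * (comp a b).Q)) *
          valProd (principalStart D) (i + 1) * valProd (principalStart D) (j + 1) by ring]
      have hX : (0 : ℝ) < (a.Q : ℝ) * b.Q / (2 * compScalar a b * (comp a b).Q) := by positivity
      have hπi := hπ (i + 1)
      have hπj := hπ (j + 1)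
      rw [Real.log_mul hr.ne' (by positivity), Real.log_mul (by positivity) hπj.ne', Real.log_mul hX.ne' hπi.ne']
      ring
    have e2 : Real.log (valProd (principalStart D) (k + 1) * fundUnit D ^ j') =
        Real.log (valProd (principalStart D) (k + 1)) + j' * Real.log (fundUnit D) := by
      rw [Real.log_mul (hπ _).ne' (zpow_ne_zero _ hε.ne'), Real.log_zpow]
    rw [hj'] at e1
    rw [e2, e3 i, e3 j, e3 k, hw'] at e1
    unfold kappaQ
    push_cast
    linarith

end HallgrenGiantStep

end Literature.Computability.Cryptography

end
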